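import Summits.Ventures.HSemireg.WedgeHankelRecurrenceCensusSymbols

/-!
# Venture HSemireg — THE POLAR CLASSES ARE (REDUCED SYMBOL, POLAR PART): for `e ≥ 1` and `2(d + e) ≤ N + 1` the polar classes of middle rank `d + e` on `[0, N]` whose minimal recurrence
# has degree `d` are in BIJECTION with the pairs (reduced symbol `a / m` of degree `d`, tail `τ` supported on the top `e` coefficients with `τ_{N+1−e} ≠ 0`) via `(m, a, τ) ↦ dualSeq m a + τ`
# — hence, over a field with `s` elements, **`#reducedSymbols(d) · (s − 1)·s^{e−1}` of them**: with N46 every column of the census of N44 is identified structurally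

HONEST FRAMING. Part of the Lean index of the computation cell `pub-hsemireg` (seat p10 gen 28, Sunday typer «UNIFORM-IN-n»).
LINEAR ALGEBRA OF HANKEL (catalecticant) MATRICES and of polynomials over a field ONLY: no variety, no cohomology theory, no sheaf, no Ext group and no semiregularity map is constructed
here; nothing here says that HC / HC_CM / HC_AV holds; no Literature fact is declared or used.  Custodian versions as in `WedgeHankelSiegelIdeal` (1/3); the dictionary (polar part of
order `e` = the point `∞` of the apolar scheme with multiplicity `e`, N34) is QUOTED, never asserted.

WHAT IS KEYED.  N46 (`WedgeHankelRecurrenceCensusSymbols`, № 328): `reducedSymbols`, `ncard_reducedSymbols`, `ncard_reducedSymbols_zero`; N44 (№ 326): `seqOf`, `seqOf_apply_of_lt`,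
`seqOf_snoc_of_le`, `seqOf_snoc_last`, `ncard_setOf_level_succ_eq_sum`; N43 (№ 323): `IsPolarClass`, `natDegree_eq_of_mem_recSpace_self`, `exists_smul_eq_of_mem_recSpace_self`,
`isAffineClass_zero_iff`; N34 (№ 267) `rank_half_eq_and_mem_recSpace_iff_exists_affine_polar`; N32 (№ 263) `dualSeq_unique`; N40 (№ 273) `exists_monic_mem_recSpace'`; N23 (№ 176)
`recSpace_congr`; N34 `rank_hankel1_half_congr`.  Mathlib: `Set.ncard_prod`, `Set.ncard_congr`.
THIS FILE (namespace `Summit.Ventures.HSemireg.Wedge.HankelOuter` continued; CHAINED on N46; 1 definition `polarParts`):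
* §565 `polarParts K N e` = the coefficient vectors on `[0, N]` vanishing below `N + 1 − e` with entry `N + 1 − e` non-zero (polar parts of exact order `e`); **`ncard_polarParts`** (`1 ≤ e ≤ N + 1 ⇒
  (s − 1)·s^{e−1}` of them; by the level recursion of N44).
* §566 `seqOf_dualSeq_add_apply`, `eq_of_eq_smul_of_monic`, **`ncard_setOf_isPolarClass_of_natDegree_eq`**: for `1 ≤ e`, `2(d + e) ≤ N + 1`, `#{v : IsPolarClass K N (d+e) (seqOf v), the minimal recurrence has degree d} = #reducedSymbols(d) ·
  #polarParts(e)` (the bijection `(m, a, τ) ↦ dualSeq m a + τ`: well-defined and onto by N34, one-to-one by the line `Rec_{d+e} = K · m`, N32's uniqueness of `a`, and subtraction).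
* §567 THE COUNTS `ncard_setOf_isPolarClass_of_natDegree_eq'` (`[Finite K]`, `d ≥ 1`: `(s − 1)·s^{2d−1} · (s − 1)·s^{e−1}`) and `ncard_setOf_isPolarClass_of_natDegree_eq_zero` (`d = 0`:
  `(s − 1)·s^{e−1}` pure polar parts); summing over `d < r` recovers N44's `P_N(r) = (s − 1)·s^{2r−2}` (not re-proved here).
Nothing Ext-side.  New names only.
-/

open Module Polynomial
open scoped Matrix Polynomial

namespace Summit.Ventures.HSemireg.Wedge.HankelOuter

open Summit.Ventures.HSemireg.Wedge Summit.Ventures.HSemireg.Wedge.Hankel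

variable (K : Type*) [Field K]

/-! ## §565. Polar parts of exact order `e` -/

/-- THE POLAR PARTS OF EXACT ORDER `e` ON `[0, N]`: coefficient vectors `τ` with `τ_j = 0` for `j + e ≤ N` and `τ_{N+1−e} ≠ 0`. [definition of this file] -/
def polarParts (N e : ℕ) : Set (Fin (N + 1) → K) := {τ | (∀ j, j + e ≤ N → seqOf K τ j = 0) ∧ seqOf K τ (N + 1 - e) ≠ 0}

/-- membership spelled out. -/
theorem mem_polarParts_iff {N e : ℕ} {τ : Fin (N + 1) → K} : τ ∈ polarParts K N e ↔ (∀ j, j + e ≤ N → seqOf K τ j = 0) ∧ seqOf K τ (N + 1 - e) ≠ 0 := Iff.rfl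

/-- there is no polar part of order `0` (the entry `N + 1` is beyond the class). -/
theorem polarParts_zero (N : ℕ) : polarParts K N 0 = ∅ :=
  Set.eq_empty_iff_forall_notMem.mpr fun τ hτ => hτ.2 (by rw [Nat.sub_zero]; unfold seqOf; rw [dif_neg (lt_irrefl _)])

omit [Field K] in
/-- counting by a filter (utility, private). -/
private theorem ncard_setOf_eq_card_filter'' {α : Type*} [Fintype α] (P : α → Prop) [DecidablePred P] : {a | P a}.ncard = (Finset.univ.filter P).card := by
  rw [← Finset.coe_filter_univ, Set.ncard_coe_finset]

/-- restriction: a polar part of order `e + 1` on `[0, N + 1]` restricts to one of order `e` on `[0, N]` (`1 ≤ e`), the new top coefficient being free; conversely. -/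
theorem snoc_mem_polarParts_succ_iff {N e : ℕ} (he : 1 ≤ e) (v : Fin (N + 1) → K) (x : K) : (Fin.snoc v x : Fin (N + 1 + 1) → K) ∈ polarParts K (N + 1) (e + 1) ↔ v ∈ polarParts K N e := by
  rw [mem_polarParts_iff, mem_polarParts_iff, show N + 1 + 1 - (e + 1) = N + 1 - e by omega, seqOf_snoc_of_le K v x (by omega)]
  exact ⟨fun h => ⟨fun j hj => by rw [← seqOf_snoc_of_le K v x (by omega)]; exact h.1 j (by omega), h.2⟩,
    fun h => ⟨fun j hj => by rw [seqOf_snoc_of_le K v x (by omega)]; exact h.1 j (by omega), h.2⟩⟩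

/-- **`#polarParts_{N+1}(e + 1) = s · #polarParts_N(e)`** (`1 ≤ e`). -/
theorem ncard_polarParts_succ_succ [Finite K] {N e : ℕ} (he : 1 ≤ e) : (polarParts K (N + 1) (e + 1)).ncard = Nat.card K * (polarParts K N e).ncard := by
  classical
  haveI := Fintype.ofFinite K
  rw [show polarParts K (N + 1) (e + 1) = {w : Fin (N + 1 + 1) → K | w ∈ polarParts K (N + 1) (e + 1)} from rfl, ncard_setOf_level_succ_eq_sum,
    show polarParts K N e = {v : Fin (N + 1) → K | v ∈ polarParts K N e} from rfl, ncard_setOf_eq_card_filter'', Finset.card_filter, Finset.mul_sum]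
  refine Finset.sum_congr rfl fun v _ => ?_
  simp only [snoc_mem_polarParts_succ_iff K he]
  split_ifs with hv
  · rw [mul_one, ← Set.ncard_univ K]; exact congrArg Set.ncard (Set.eq_univ_of_forall fun x => hv)
  · rw [mul_zero, (Set.eq_empty_iff_forall_notMem.mpr fun x hx => hv hx : {x : K | v ∈ polarParts K N e} = ∅), Set.ncard_empty]

/-- order `1` on `[0, N + 1]`: the restriction to `[0, N]` vanishes and the top coefficient is non-zero. -/
theorem snoc_mem_polarParts_one_iff {N : ℕ} (v : Fin (N + 1) → K) (x : K) : (Fin.snoc v x : Fin (N + 1 + 1) → K) ∈ polarParts K (N + 1) 1 ↔ (∀ j ≤ N, seqOf K v j = 0) ∧ x ≠ 0 := by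
  rw [mem_polarParts_iff, show N + 1 + 1 - 1 = N + 1 by omega, seqOf_snoc_last]
  exact ⟨fun h => ⟨fun j hj => by rw [← seqOf_snoc_of_le K v x hj]; exact h.1 j (by omega), h.2⟩,
    fun h => ⟨fun j hj => by rw [seqOf_snoc_of_le K v x (by omega)]; exact h.1 j (by omega), h.2⟩⟩

/-- **`#polarParts_N(1) = s − 1`** (`τ = (0, …, 0, x)`, `x ≠ 0`). -/
theorem ncard_polarParts_one [Finite K] : ∀ N : ℕ, (polarParts K N 1).ncard = Nat.card K - 1
  | 0 => by
    have key : polarParts K 0 1 = Set.univ \ {0} := by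
      ext τ
      rw [mem_polarParts_iff, Set.mem_sdiff, Set.mem_singleton_iff, show 0 + 1 - 1 = 0 from rfl, seqOf_apply_of_lt K τ (show 0 < 0 + 1 by omega)]
      refine ⟨fun h => ⟨Set.mem_univ τ, fun h0 => h.2 (by rw [h0]; rfl)⟩, fun h => ⟨fun j hj => by omega, fun h0 => h.2 (funext fun i => ?_)⟩⟩
      rw [show i = ⟨0, by omega⟩ from Fin.ext (by have := i.2; omega), Pi.zero_apply]; exact h0
    rw [key, Set.ncard_sdiff_singleton_of_mem (Set.mem_univ _), Set.ncard_univ, Nat.card_fun, Nat.card_eq_fintype_card (α := Fin (0 + 1)), Fintype.card_fin, pow_one]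
  | N + 1 => by
    classical
    haveI := Fintype.ofFinite K
    rw [show polarParts K (N + 1) 1 = {w : Fin (N + 1 + 1) → K | w ∈ polarParts K (N + 1) 1} from rfl, ncard_setOf_level_succ_eq_sum]
    have hfib : ∀ v : Fin (N + 1) → K, {x : K | (Fin.snoc v x : Fin (N + 1 + 1) → K) ∈ polarParts K (N + 1) 1}.ncard
        = (Nat.card K - 1) * (if IsAffineClass K N 0 (seqOf K v) then 1 else 0) := by
      intro v
      rw [isAffineClass_zero_iff]
      simp only [snoc_mem_polarParts_one_iff]
      split_ifs with hv
      · have key : {x : K | (∀ j ≤ N, seqOf K v j = 0) ∧ x ≠ 0} = Set.univ \ {0} := by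
          ext x; rw [Set.mem_setOf_eq, Set.mem_sdiff, Set.mem_singleton_iff]; exact ⟨fun h => ⟨Set.mem_univ x, h.2⟩, fun h => ⟨hv, h.2⟩⟩
        rw [key, Set.ncard_sdiff_singleton_of_mem (Set.mem_univ _), Set.ncard_univ, mul_one]
      · have key : {x : K | (∀ j ≤ N, seqOf K v j = 0) ∧ x ≠ 0} = ∅ := Set.eq_empty_iff_forall_notMem.mpr fun x hx => hv hx.1
        rw [key, Set.ncard_empty, mul_zero]
    rw [Finset.sum_congr rfl fun v _ => hfib v, ← Finset.mul_sum, ← Finset.card_filter, ← ncard_setOf_eq_card_filter'', ncard_setOf_isAffineClass_zero, mul_one]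

/-- **THE NUMBER OF POLAR PARTS OF EXACT ORDER `e`: `(s − 1)·s^{e−1}` for `1 ≤ e ≤ N + 1`.** -/
theorem ncard_polarParts [Finite K] : ∀ {N e : ℕ}, 1 ≤ e → e ≤ N + 1 → (polarParts K N e).ncard = (Nat.card K - 1) * Nat.card K ^ (e - 1)
  | N, 0, he, _ => by omega
  | N, 1, _, _ => by rw [ncard_polarParts_one, Nat.sub_self, pow_zero, mul_one]
  | 0, e + 2, _, heN => by omega
  | N + 1, e + 2, _, heN => by
    rw [ncard_polarParts_succ_succ K (by omega), ncard_polarParts (N := N) (e := e + 1) (by omega) (by omega), show e + 2 - 1 = (e + 1 - 1) + 1 by omega, pow_succ]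
    ring

/-! ## §566. The bijection: (reduced symbol of degree `d`, polar part of order `e`) ↦ polar class of rank `d + e` with minimal recurrence of degree `d` -/

/-- reading a coefficient vector plus a tail as a sequence on `[0, N]`. -/
theorem seqOf_dualSeq_add_apply {N : ℕ} (m a : K[X]) (τ : Fin (N + 1) → K) {j : ℕ} (hj : j ≤ N) :
    seqOf K (fun i : Fin (N + 1) => dualSeq K m a i + τ i) j = dualSeq K m a j + seqOf K τ j := by
  rw [seqOf_apply_of_lt K _ (show j < N + 1 by omega), seqOf_apply_of_lt K _ (show j < N + 1 by omega)]

/-- a scalar multiple of a monic polynomial that is monic is the polynomial itself. -/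
theorem eq_of_eq_smul_of_monic {m m' : K[X]} (hm : m.Monic) (hm' : m'.Monic) {c : K} (h : m' = c • m) : m = m' := by
  have hlc := congrArg Polynomial.leadingCoeff h
  rw [Polynomial.smul_eq_C_mul, Polynomial.leadingCoeff_mul, Polynomial.leadingCoeff_C, hm.leadingCoeff, hm'.leadingCoeff, mul_one] at hlc
  rw [h, ← hlc, one_smul]

/-- **THE POLAR CLASSES OF RANK `d + e` WITH MINIMAL RECURRENCE OF DEGREE `d` ARE THE PAIRS (REDUCED SYMBOL OF DEGREE `d`, POLAR PART OF ORDER `e`)** (`1 ≤ e`, `2(d + e) ≤ N + 1`):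
`#{v : IsPolarClass K N (d+e) (seqOf v) ∧ ∃ m ∈ Rec_{d+e}(seqOf v), m ≠ 0 ∧ deg m = d} = #reducedSymbols(d) · #polarParts(e)` via `((m, a), τ) ↦ (i ↦ dualSeq m a i + τ i)`. -/
theorem ncard_setOf_isPolarClass_of_natDegree_eq {N d e : ℕ} (he : 1 ≤ e) (h2 : d + e + (d + e) ≤ N + 1) :
    {v : Fin (N + 1) → K | IsPolarClass K N (d + e) (seqOf K v) ∧ ∃ m ∈ recSpace K N (seqOf K v) (d + e), m ≠ 0 ∧ m.natDegree = d}.ncard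
      = (reducedSymbols K d).ncard * (polarParts K N e).ncard := by
  rw [← Set.ncard_prod]
  symm
  refine Set.ncard_congr (fun p _ => fun i : Fin (N + 1) => dualSeq K p.1.1 p.1.2 i + p.2 i) ?_ ?_ ?_
  · -- well-defined (N34, converse direction)
    rintro ⟨⟨m, a⟩, τ⟩ ⟨⟨hm, hmd, ha, hcop⟩, hτ0, hτe⟩
    dsimp only at hm hmd ha hcop hτ0 hτe ⊢
    have hagree : ∀ j ≤ N, seqOf K (fun i : Fin (N + 1) => dualSeq K m a i + τ i) j = (dualSeq K m a + seqOf K τ) j := fun j hj => by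
      rw [Pi.add_apply, seqOf_dualSeq_add_apply K m a τ hj]
    have key := (rank_half_eq_and_mem_recSpace_iff_exists_affine_polar K (N := N) hm he (by rw [hmd]; exact h2) (dualSeq K m a + seqOf K τ)).mpr
      ⟨a, seqOf K τ, hcop, by rw [hmd]; exact ha, hτ0, hτe, fun j _ => rfl⟩
    rw [hmd] at key
    rw [Set.mem_setOf_eq, isPolarClass_congr K hagree, recSpace_congr K hagree]
    exact ⟨⟨key.1, fun m' hm' hm0' => by rw [natDegree_eq_of_mem_recSpace_self K key.1 h2 key.2 hm.ne_zero hm' hm0', hmd]; omega⟩, m, key.2, hm.ne_zero, hmd⟩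
  · -- one-to-one: the line `Rec_{d+e} = K · m` recovers `m`, then `a` (N32), then `τ` by subtraction
    rintro ⟨⟨m, a⟩, τ⟩ ⟨⟨m', a'⟩, τ'⟩ ⟨⟨hm, hmd, ha, hcop⟩, hτ0, hτe⟩ ⟨⟨hm', hmd', ha', hcop'⟩, hτ0', hτe'⟩ h
    dsimp only at hm hmd ha hcop hτ0 hτe hm' hmd' ha' hcop' hτ0' hτe' h ⊢
    have hpt : ∀ i : Fin (N + 1), dualSeq K m a i + τ i = dualSeq K m' a' i + τ' i := fun i => congrFun h i
    have hq : ∀ j ≤ N, (dualSeq K m a + seqOf K τ) j = (dualSeq K m' a' + seqOf K τ') j := fun j hj => by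
      rw [Pi.add_apply, Pi.add_apply, seqOf_apply_of_lt K τ (show j < N + 1 by omega), seqOf_apply_of_lt K τ' (show j < N + 1 by omega)]; exact hpt ⟨j, by omega⟩
    have key := (rank_half_eq_and_mem_recSpace_iff_exists_affine_polar K (N := N) hm he (by rw [hmd]; exact h2) (dualSeq K m a + seqOf K τ)).mpr
      ⟨a, seqOf K τ, hcop, by rw [hmd]; exact ha, hτ0, hτe, fun j _ => rfl⟩
    have key' := (rank_half_eq_and_mem_recSpace_iff_exists_affine_polar K (N := N) hm' he (by rw [hmd']; exact h2) (dualSeq K m' a' + seqOf K τ')).mpr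
      ⟨a', seqOf K τ', hcop', by rw [hmd']; exact ha', hτ0', hτe', fun j _ => rfl⟩
    rw [hmd] at key
    rw [hmd', ← recSpace_congr K hq] at key'
    obtain ⟨c, hc⟩ := exists_smul_eq_of_mem_recSpace_self K key.1 h2 key.2 hm.ne_zero key'.2
    obtain rfl : m = m' := eq_of_eq_smul_of_monic K hm hm' hc
    have haa' : a = a' := dualSeq_unique K (N := N - e) hm (by omega) (hmd ▸ ha) (hmd ▸ ha') fun j hj => by
      have h1 := hq j (by omega)
      rw [Pi.add_apply, Pi.add_apply, hτ0 j (by omega), hτ0' j (by omega)] at h1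
      simpa using h1
    subst haa'
    have hττ' : τ = τ' := funext fun i => add_left_cancel (hpt i)
    subst hττ'
    rfl
  · -- onto (N40's normalisation + N34, direct direction)
    rintro v ⟨hP, m₀, hm₀, hm₀0, hm₀d⟩
    obtain ⟨m, hmo, hdeg, hm, -⟩ := exists_monic_mem_recSpace' K hm₀ hm₀0
    rw [hm₀d] at hdeg
    obtain ⟨a, τ', hcop, ha, hτ0, hτe, hdec⟩ := (rank_half_eq_and_mem_recSpace_iff_exists_affine_polar K (N := N) hmo he (by rw [hdeg]; exact h2) (seqOf K v)).mp
      ⟨by rw [hdeg]; exact hP.rank_eq, by rw [hdeg]; exact hm⟩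
    have hτ' : ∀ j ≤ N, seqOf K (fun i : Fin (N + 1) => τ' i) j = τ' j := fun j hj => by rw [seqOf_apply_of_lt K _ (show j < N + 1 by omega)]
    refine ⟨((m, a), fun i => τ' i), Set.mk_mem_prod ⟨hmo, hdeg, hdeg ▸ ha, hcop⟩ ⟨fun j hj => by rw [hτ' j (by omega)]; exact hτ0 j hj, by rw [hτ' _ (by omega)]; exact hτe⟩,
      funext fun i => ?_⟩
    dsimp only
    rw [← seqOf_apply_of_lt K v i.2]
    exact (hdec i (by have := i.2; omega)).symm

/-! ## §567. The count of polar classes by the degree of the minimal recurrence -/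

/-- **over a field with `s` elements, for `1 ≤ d`, `1 ≤ e`, `2(d + e) ≤ N + 1`, exactly `(s − 1)·s^{2d−1} · (s − 1)·s^{e−1}` polar classes of rank `d + e` on `[0, N]` have minimal
recurrence of degree `d`** (N46's count of reduced symbols times §565's count of polar parts). -/
theorem ncard_setOf_isPolarClass_of_natDegree_eq' [Finite K] {N d e : ℕ} (hd : 1 ≤ d) (he : 1 ≤ e) (h2 : d + e + (d + e) ≤ N + 1) :
    {v : Fin (N + 1) → K | IsPolarClass K N (d + e) (seqOf K v) ∧ ∃ m ∈ recSpace K N (seqOf K v) (d + e), m ≠ 0 ∧ m.natDegree = d}.ncard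
      = ((Nat.card K - 1) * Nat.card K ^ (2 * d - 1)) * ((Nat.card K - 1) * Nat.card K ^ (e - 1)) := by
  rw [ncard_setOf_isPolarClass_of_natDegree_eq K he h2, ncard_reducedSymbols K hd, ncard_polarParts K he (by omega)]

/-- **… and `(s − 1)·s^{e−1}` polar classes of rank `e` have minimal recurrence `1` (degree `0`): the pure polar parts.** -/
theorem ncard_setOf_isPolarClass_of_natDegree_eq_zero [Finite K] {N e : ℕ} (he : 1 ≤ e) (h2 : e + e ≤ N + 1) :
    {v : Fin (N + 1) → K | IsPolarClass K N e (seqOf K v) ∧ ∃ m ∈ recSpace K N (seqOf K v) e, m ≠ 0 ∧ m.natDegree = 0}.ncard = (Nat.card K - 1) * Nat.card K ^ (e - 1) := by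
  have h := ncard_setOf_isPolarClass_of_natDegree_eq K (N := N) (d := 0) he (by omega)
  rw [Nat.zero_add] at h
  rw [h, ncard_reducedSymbols_zero, ncard_polarParts K he (by omega), one_mul]

end Summit.Ventures.HSemireg.Wedge.HankelOuter
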